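import Mathlib
import HarnessLib
import Literature.Analysis.FluidPDE.VorticityCalculus
import Summits.NavierStokesRegularity.NavierStokesRegularity.Theorems.ChiralWindowDoorDefs
import Summits.NavierStokesRegularity.NavierStokesRegularity.Theorems.ChiralWindowDoorLocalHelicityLower

/-!
# Door S20 «ChiralWindowDoor» — stub B3, step 2: the localised helicity FLUX of a door-class profile is
# `O(R²/(R+√(−t))⁴)`, hence `O(1)` in `∫dt` uniformly in `R`

Door S20 of nsreg-p1's local Type-I door family (`HOME/ns-regularity-ideate-p1/r19/R19-LINE.md` §B3, line
`r19/Sketch20v5.lean` 7f13084196f4f031; DESIGN-ONLY, route NOT born).  In the localised helicity identity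
`d/dt h(a_R, v) = F_R(t) − 2 h(a_R, ω)` (`…ChiralWindowDoorHelicityBudgetIdentity.hasDerivAt_locHelicity_dissipation`)
with the weight `a_R = η(·/R)²`, the flux is
`F_R(t) = ∫⟪v,ω⟫(∇a_R·v) + ∫(q − ½|v|²)(∇a_R·ω) − ∫⟪curl ω, ∇a_R × v⟫`.
Every term carries `∇a_R`, which lives on the annulus `R ≤ ‖x‖ ≤ 2R` and is `≤ M₁/R`; with the scale-invariant
bounds of the class (`‖v‖ ≤ D/(‖x‖+√(−t))`, `(·)²‖∇v‖, (·)²|q|, (·)³‖∇²v‖ ≤ K` — the package of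
`…ChiralWindowDoorClassDerivDecay.pressureDecay_of_class`) each integrand is `≲ 1/(R (R+√(−t))⁴)` there, so that
`|F_R(t)| ≤ C_F · R²/(R+√(−t))⁴` with `C_F` independent of `R` and `t`; and `∫_{t<0} R²/(R+√(−t))⁴ dt ≤ 1`
(`…ChiralWindowDoorTimeIntegratedError.integral_Iio_kernel_le` with `b = R`).  This is the scale invariance of the
helicity made quantitative.

* `exists_norm_fderiv_bumpSq_le`, `fderiv_bumpSq_eq_zero_of_norm_lt`, `fderiv_bumpSq_eq_zero_of_lt_norm` — the weight
  gradient: `‖∇a_R‖ ≤ M₁/R`, `∇a_R = 0` off the annulus;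
* `abs_integral_le_of_ball_bound` — `|∫ g| ≤ |B_{2R}| · B` for `|g| ≤ B` on `B_{2R}`, `g = 0` outside;
* `exists_helicityFlux_bound` — **`|F_R(t)| ≤ C_F · R² ((R+√(−t))⁴)⁻¹`** for all `R > 0`, `t < 0`.

Seat nsreg-p6 g12 (THEOREMS-ONLY door sequels, DIRECTOR-NS g8 #32 (2)/#36).  WHAT THIS IS NOT: not NS regularity
(Clay A); not B3 yet (the integration over `(−∞,t₀]` is the next file); no route is opened.
-/

noncomputable section

-- the summit and its single sub-problem share the name (CONVENTIONS §1), as in every Theorems file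
set_option linter.dupNamespace false

namespace Summit.NavierStokesRegularity.NavierStokesRegularity.Theorems.ChiralWindowDoorHelicityFluxBounds

open MeasureTheory Set Filter Topology Metric Function
open scoped RealInnerProductSpace
open Literature.Analysis Literature.Analysis.FluidPDE
open Summit.NavierStokesRegularity.NavierStokesRegularity.Theorems.ChiralWindowDoorDefs
open Summit.NavierStokesRegularity.NavierStokesRegularity.Theorems.ChiralWindowDoorLocalHelicityLower
  (bumpSq_eq_comp_one contDiff_bumpSq hasCompactSupport_bumpSq)

variable {η : EuclideanSpace ℝ (Fin 3) → ℝ}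

/-! ### The gradient of the weight `a_R` -/

/-- **`‖∇a_R(x)‖ ≤ M₁/R`** uniformly in `x` and `R > 0` (`a_R = a₁ ∘ (R⁻¹ •)`, `a₁` is `C²` with compact support). -/
theorem exists_norm_fderiv_bumpSq_le (hη : IsAdmissibleBump η) :
    ∃ M₁ : ℝ, 0 ≤ M₁ ∧ ∀ R > (0 : ℝ), ∀ x, ‖fderiv ℝ (bumpSq η R) x‖ ≤ M₁ / R := by
  have hcd : ContDiff ℝ 2 (bumpSq η 1) := contDiff_bumpSq hη 1
  have hc1 : ContDiff ℝ 1 (bumpSq η 1) := hcd.of_le (by norm_cast)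
  have hcont : Continuous fun y => ‖fderiv ℝ (bumpSq η 1) y‖ := (hc1.continuous_fderiv one_ne_zero).norm
  have hsupp : HasCompactSupport fun y => ‖fderiv ℝ (bumpSq η 1) y‖ :=
    ((hasCompactSupport_bumpSq hη one_pos).fderiv (𝕜 := ℝ)).norm
  obtain ⟨M, hM⟩ := hcont.bounded_above_of_compact_support hsupp
  have hM' : ∀ y, ‖fderiv ℝ (bumpSq η 1) y‖ ≤ M := fun y =>
    (le_abs_self _).trans ((Real.norm_eq_abs _).symm.le.trans (hM y))
  have hM0 : 0 ≤ M := (norm_nonneg _).trans (hM' 0)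
  refine ⟨M, hM0, fun R hR x => ?_⟩
  have hdiff : DifferentiableAt ℝ (bumpSq η 1) (R⁻¹ • x) := (hc1.differentiable one_ne_zero) _
  have h1 : HasFDerivAt (fun y : EuclideanSpace ℝ (Fin 3) => R⁻¹ • y)
      (R⁻¹ • ContinuousLinearMap.id ℝ (EuclideanSpace ℝ (Fin 3))) x := (hasFDerivAt_id x).const_smul R⁻¹
  have h2 := hdiff.hasFDerivAt.comp x h1
  have heq : (bumpSq η 1 ∘ fun y : EuclideanSpace ℝ (Fin 3) => R⁻¹ • y) = bumpSq η R := by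
    funext y; exact (bumpSq_eq_comp_one η R y).symm
  rw [heq] at h2
  rw [h2.fderiv, ContinuousLinearMap.comp_smul, ContinuousLinearMap.comp_id, norm_smul, Real.norm_eq_abs,
    abs_of_pos (inv_pos.2 hR), div_eq_inv_mul]
  exact mul_le_mul_of_nonneg_left (hM' _) (inv_pos.2 hR).le

/-- `∇a_R(x) = 0` for `‖x‖ < R` (`a_R = 1` near `x`). -/
theorem fderiv_bumpSq_eq_zero_of_norm_lt (hη : IsAdmissibleBump η) {R : ℝ} (hR : 0 < R)
    {x : EuclideanSpace ℝ (Fin 3)} (hx : ‖x‖ < R) : fderiv ℝ (bumpSq η R) x = 0 := by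
  have hev : bumpSq η R =ᶠ[𝓝 x] fun _ => (1 : ℝ) := by
    have hopen : IsOpen {y : EuclideanSpace ℝ (Fin 3) | ‖y‖ < R} := isOpen_lt continuous_norm continuous_const
    filter_upwards [hopen.mem_nhds hx] with y hy
    exact bumpSq_eq_one hη hR (le_of_lt hy)
  rw [hev.fderiv_eq, fderiv_const_apply]

/-- `∇a_R(x) = 0` for `2R < ‖x‖` (`a_R = 0` near `x`). -/
theorem fderiv_bumpSq_eq_zero_of_lt_norm (hη : IsAdmissibleBump η) {R : ℝ} (hR : 0 < R)
    {x : EuclideanSpace ℝ (Fin 3)} (hx : 2 * R < ‖x‖) : fderiv ℝ (bumpSq η R) x = 0 := by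
  have hev : bumpSq η R =ᶠ[𝓝 x] fun _ => (0 : ℝ) := by
    have hopen : IsOpen {y : EuclideanSpace ℝ (Fin 3) | 2 * R < ‖y‖} := isOpen_lt continuous_const continuous_norm
    filter_upwards [hopen.mem_nhds hx] with y hy
    exact bumpSq_eq_zero hη hR (le_of_lt hy)
  rw [hev.fderiv_eq, fderiv_const_apply]

/-! ### An integral over the ball `B_{2R}` -/

/-- `|B_{2R}| = 8R³|B₁|` in `ℝ³`. -/
theorem volume_real_closedBall_two_mul {R : ℝ} (hR : 0 ≤ R) :
    (volume : Measure (EuclideanSpace ℝ (Fin 3))).real (closedBall 0 (2 * R)) =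
      8 * R ^ 3 * (volume : Measure (EuclideanSpace ℝ (Fin 3))).real (closedBall 0 1) := by
  rw [Measure.addHaar_real_closedBall' volume (0 : EuclideanSpace ℝ (Fin 3)) (by positivity : 0 ≤ 2 * R),
    finrank_euclideanSpace_fin]
  ring

/-- **`|∫ g| ≤ 8|B₁| R³ B`** for a function with `|g| ≤ B` on `‖x‖ ≤ 2R` and `g = 0` for `‖x‖ > 2R` (no integrability
needed: the junk value `0` obeys the bound). -/
theorem abs_integral_le_of_ball_bound {g : EuclideanSpace ℝ (Fin 3) → ℝ} {R B : ℝ} (hR : 0 < R)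
    (hin : ∀ x, ‖x‖ ≤ 2 * R → |g x| ≤ B) (hout : ∀ x, 2 * R < ‖x‖ → g x = 0) :
    |∫ x, g x| ≤ 8 * (volume : Measure (EuclideanSpace ℝ (Fin 3))).real (closedBall 0 1) * R ^ 3 * B := by
  have hbd : ∀ x, ‖g x‖ ≤ (closedBall (0 : EuclideanSpace ℝ (Fin 3)) (2 * R)).indicator (fun _ => B) x := by
    intro x
    by_cases hx : x ∈ closedBall (0 : EuclideanSpace ℝ (Fin 3)) (2 * R)
    · rw [indicator_of_mem hx, Real.norm_eq_abs]
      exact hin x (by simpa [mem_closedBall, dist_zero_right] using hx)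
    · rw [indicator_of_notMem hx]
      have hx' : 2 * R < ‖x‖ := by
        have : ¬ ‖x‖ ≤ 2 * R := by simpa [mem_closedBall, dist_zero_right] using hx
        exact lt_of_not_ge this
      rw [hout x hx', norm_zero]
  have hint : Integrable ((closedBall (0 : EuclideanSpace ℝ (Fin 3)) (2 * R)).indicator fun _ => B) :=
    IntegrableOn.integrable_indicator (integrableOn_const (measure_closedBall_lt_top.ne)) measurableSet_closedBall
  rw [← Real.norm_eq_abs]
  refine (norm_integral_le_of_norm_le hint (ae_of_all _ hbd)).trans (le_of_eq ?_)
  rw [integral_indicator measurableSet_closedBall, setIntegral_const, smul_eq_mul,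
    volume_real_closedBall_two_mul hR.le]
  ring

/-! ### Scale-invariant pointwise bookkeeping -/

/-- From `b^n · y ≤ K`, `0 ≤ y` and `0 < β ≤ b`: `y ≤ K / β^n`. -/
theorem le_div_pow_of_mul_le {b β K y : ℝ} {n : ℕ} (hβ : 0 < β) (hb : β ≤ b) (hy : 0 ≤ y) (h : b ^ n * y ≤ K) :
    y ≤ K / β ^ n := by
  have hβn : 0 < β ^ n := pow_pos hβ n
  have hle : β ^ n ≤ b ^ n := pow_le_pow_left₀ hβ.le hb n
  rw [le_div_iff₀ hβn]
  calc y * β ^ n ≤ y * b ^ n := mul_le_mul_of_nonneg_left hle hy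
    _ = b ^ n * y := mul_comm _ _
    _ ≤ K := h

/-! ### The flux bound -/

variable {D K : ℝ} {v : ℝ → EuclideanSpace ℝ (Fin 3) → EuclideanSpace ℝ (Fin 3)} {q : ℝ → EuclideanSpace ℝ (Fin 3) → ℝ}

/-- **The localised helicity flux of a door-class profile is `O(R²/(R+√(−t))⁴)`.**  For a classical unit-viscosity
solution `(v, q)` on `(−∞,0)` with the Type-I decay `‖v‖ ≤ D/(‖x‖+√(−t))` and the scale-invariant package
`(·)²|q| ≤ K`, `(·)²‖∇v‖ ≤ K`, `(·)³‖∇²v‖ ≤ K` (the conclusion of `…ClassDerivDecay.pressureDecay_of_class`), and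
the weights `a_R = η(·/R)²` of an admissible bump: there is `C_F ≥ 0` with
`|∫⟪v,ω⟫(∇a_R·v) + ∫(q − ½|v|²)(∇a_R·ω) − ∫⟪curl ω, ∇a_R × v⟫| ≤ C_F · R² ((R+√(−t))⁴)⁻¹` for all `R > 0`, `t < 0`. -/
theorem exists_helicityFlux_bound (hη : IsAdmissibleBump η) (hdecay : HasTypeIDecay D v)
    (hsol : IsClassicalNSSolutionOn (Iio (0 : ℝ)) 1 0 v q)
    (hK : ∀ t < (0 : ℝ), ∀ (x : EuclideanSpace ℝ (Fin 3)), (‖x‖ + Real.sqrt (-t)) ^ 2 * |q t x| ≤ K ∧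
      (‖x‖ + Real.sqrt (-t)) ^ 3 * ‖gradient (q t) x‖ ≤ K ∧ (‖x‖ + Real.sqrt (-t)) ^ 2 * ‖fderiv ℝ (v t) x‖ ≤ K ∧
      (‖x‖ + Real.sqrt (-t)) ^ 3 * ‖iteratedFDeriv ℝ 2 (v t) x‖ ≤ K ∧
      (‖x‖ + Real.sqrt (-t)) ^ 3 * ‖deriv (fun τ => v τ x) t‖ ≤ K) :
    ∃ C_F : ℝ, 0 ≤ C_F ∧ ∀ R > (0 : ℝ), ∀ t < (0 : ℝ),
      |(∫ x, ⟪v t x, curl (v t) x⟫ * fderiv ℝ (bumpSq η R) x (v t x)) +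
          (∫ x, (q t x - (1 / 2) * ‖v t x‖ ^ 2) * fderiv ℝ (bumpSq η R) x (curl (v t) x)) -
          (∫ x, ⟪curl (curl (v t)) x, curlCLM ((fderiv ℝ (bumpSq η R) x).smulRight (v t x))⟫)| ≤
        C_F * (R ^ 2 * ((R + Real.sqrt (-t)) ^ 4)⁻¹) := by
  obtain ⟨M₁, hM₁, hDa⟩ := exists_norm_fderiv_bumpSq_le hη
  set κ : ℝ := ‖(curlCLM : (EuclideanSpace ℝ (Fin 3) →L[ℝ] EuclideanSpace ℝ (Fin 3)) →L[ℝ] EuclideanSpace ℝ (Fin 3))‖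
    with hκ
  have hκ0 : 0 ≤ κ :=
    norm_nonneg ((curlCLM : (EuclideanSpace ℝ (Fin 3) →L[ℝ] EuclideanSpace ℝ (Fin 3)) →L[ℝ] EuclideanSpace ℝ (Fin 3)))
  set V₁ : ℝ := (volume : Measure (EuclideanSpace ℝ (Fin 3))).real (closedBall 0 1) with hV₁
  have hV₁0 : 0 ≤ V₁ := measureReal_nonneg
  -- signs of the constants
  have hD : 0 ≤ D := by
    have h := hdecay (-1) (by norm_num) 0
    have hpos : 0 < ‖(0 : EuclideanSpace ℝ (Fin 3))‖ + Real.sqrt (-(-1 : ℝ)) := by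
      rw [norm_zero, zero_add]; exact Real.sqrt_pos.2 (by norm_num)
    by_contra hD
    push Not at hD
    have : D / (‖(0 : EuclideanSpace ℝ (Fin 3))‖ + Real.sqrt (-(-1 : ℝ))) < 0 := div_neg_of_neg_of_pos hD hpos
    linarith [norm_nonneg (v (-1) 0)]
  have hK0 : 0 ≤ K := le_trans (by positivity) ((hK (-1) (by norm_num) 0).2.2.1)
  -- the three constants and `C_F`
  set c₁ : ℝ := κ * K * D ^ 2 * M₁ with hc₁
  set c₂ : ℝ := κ * K * M₁ * (K + D ^ 2 / 2) with hc₂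
  set c₃ : ℝ := κ ^ 3 * K * M₁ * D with hc₃
  refine ⟨8 * V₁ * (c₁ + c₂ + c₃), by positivity, fun R hR t ht => ?_⟩
  have hnt : 0 < -t := neg_pos.2 ht
  have hsq : 0 < Real.sqrt (-t) := Real.sqrt_pos.2 hnt
  set β : ℝ := R + Real.sqrt (-t) with hβ
  have hβ0 : 0 < β := by positivity
  have hv2 : ContDiff ℝ 2 (v t) := contDiff_infty.1 (hsol.contDiff_velocity ht) 2
  -- pointwise decay on the annulus `R ≤ ‖x‖`
  have hdec : ∀ x : EuclideanSpace ℝ (Fin 3), R ≤ ‖x‖ →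
      ‖v t x‖ ≤ D / β ∧ ‖curl (v t) x‖ ≤ κ * K / β ^ 2 ∧ |q t x| ≤ K / β ^ 2 ∧
        ‖curl (curl (v t)) x‖ ≤ κ ^ 2 * K / β ^ 3 := by
    intro x hx
    have hb : β ≤ ‖x‖ + Real.sqrt (-t) := by rw [hβ]; linarith
    obtain ⟨hq, -, h1, h2, -⟩ := hK t ht x
    have hv : ‖v t x‖ ≤ D / β := (hdecay t ht x).trans (div_le_div_of_nonneg_left hD hβ0 hb)
    have hDv : ‖fderiv ℝ (v t) x‖ ≤ K / β ^ 2 := le_div_pow_of_mul_le hβ0 hb (norm_nonneg _) h1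
    have hD2v : ‖iteratedFDeriv ℝ 2 (v t) x‖ ≤ K / β ^ 3 := le_div_pow_of_mul_le hβ0 hb (norm_nonneg _) h2
    have hq' : |q t x| ≤ K / β ^ 2 := le_div_pow_of_mul_le hβ0 hb (abs_nonneg _) hq
    refine ⟨hv, ?_, hq', ?_⟩
    · rw [mul_div_assoc]; exact (norm_curl_le _ _).trans (mul_le_mul_of_nonneg_left hDv hκ0)
    · rw [pow_two, mul_assoc, mul_div_assoc, mul_div_assoc]
      refine (norm_curl_le _ _).trans (mul_le_mul_of_nonneg_left ?_ hκ0)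
      exact (norm_fderiv_curl_le hv2 x).trans (mul_le_mul_of_nonneg_left hD2v hκ0)
  -- the three integrands
  set T₁ : EuclideanSpace ℝ (Fin 3) → ℝ := fun x => ⟪v t x, curl (v t) x⟫ * fderiv ℝ (bumpSq η R) x (v t x) with hT₁
  set T₂ : EuclideanSpace ℝ (Fin 3) → ℝ := fun x =>
    (q t x - (1 / 2) * ‖v t x‖ ^ 2) * fderiv ℝ (bumpSq η R) x (curl (v t) x) with hT₂
  set T₃ : EuclideanSpace ℝ (Fin 3) → ℝ := fun x =>
    ⟪curl (curl (v t)) x, curlCLM ((fderiv ℝ (bumpSq η R) x).smulRight (v t x))⟫ with hT₃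
  -- they vanish where `∇a_R = 0`
  have hzero : ∀ x, fderiv ℝ (bumpSq η R) x = 0 → T₁ x = 0 ∧ T₂ x = 0 ∧ T₃ x = 0 := fun x h0 => by
    have hsr : (0 : EuclideanSpace ℝ (Fin 3) →L[ℝ] ℝ).smulRight (v t x) = 0 := by
      ext y; simp
    simp only [hT₁, hT₂, hT₃, h0, _root_.zero_apply, mul_zero, hsr, map_zero, inner_zero_right, and_self]
  have hout : ∀ x, 2 * R < ‖x‖ → T₁ x = 0 ∧ T₂ x = 0 ∧ T₃ x = 0 := fun x hx =>
    hzero x (fderiv_bumpSq_eq_zero_of_lt_norm hη hR hx)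
  -- pointwise bounds on `‖x‖ ≤ 2R`
  have hin : ∀ x, ‖x‖ ≤ 2 * R →
      |T₁ x| ≤ c₁ / (R * β ^ 4) ∧ |T₂ x| ≤ c₂ / (R * β ^ 4) ∧ |T₃ x| ≤ c₃ / (R * β ^ 4) := by
    intro x _hx2
    by_cases hxR : ‖x‖ < R
    · obtain ⟨e1, e2, e3⟩ := hzero x (fderiv_bumpSq_eq_zero_of_norm_lt hη hR hxR)
      rw [e1, e2, e3, abs_zero]
      exact ⟨by positivity, by positivity, by positivity⟩
    obtain ⟨hv, hω, hq', hωω⟩ := hdec x (not_lt.1 hxR)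
    have ha := hDa R hR x
    refine ⟨?_, ?_, ?_⟩
    · -- `|⟪v,ω⟫ ∇a(v)| ≤ (D/β)(κK/β²) · (M₁/R)(D/β)`
      have h1 : |⟪v t x, curl (v t) x⟫| ≤ D / β * (κ * K / β ^ 2) :=
        (abs_real_inner_le_norm _ _).trans (mul_le_mul hv hω (norm_nonneg _) (by positivity))
      have h2 : |fderiv ℝ (bumpSq η R) x (v t x)| ≤ M₁ / R * (D / β) := by
        rw [← Real.norm_eq_abs]
        exact (ContinuousLinearMap.le_opNorm _ _).trans (mul_le_mul ha hv (norm_nonneg _) (by positivity))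
      calc |T₁ x| = |⟪v t x, curl (v t) x⟫| * |fderiv ℝ (bumpSq η R) x (v t x)| := by rw [hT₁]; exact abs_mul _ _
        _ ≤ D / β * (κ * K / β ^ 2) * (M₁ / R * (D / β)) :=
            mul_le_mul h1 h2 (abs_nonneg _) (by positivity)
        _ = c₁ / (R * β ^ 4) := by rw [hc₁]; field_simp
    · -- `|(q − ½|v|²) ∇a(ω)| ≤ (K/β² + ½ D²/β²) · (M₁/R)(κK/β²)`
      have h1 : |q t x - (1 / 2) * ‖v t x‖ ^ 2| ≤ K / β ^ 2 + (1 / 2) * (D / β) ^ 2 := by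
        refine (abs_sub _ _).trans (add_le_add hq' ?_)
        rw [abs_of_nonneg (by positivity)]
        exact mul_le_mul_of_nonneg_left (pow_le_pow_left₀ (norm_nonneg _) hv 2) (by norm_num)
      have h2 : |fderiv ℝ (bumpSq η R) x (curl (v t) x)| ≤ M₁ / R * (κ * K / β ^ 2) := by
        rw [← Real.norm_eq_abs]
        exact (ContinuousLinearMap.le_opNorm _ _).trans (mul_le_mul ha hω (norm_nonneg _) (by positivity))
      calc |T₂ x| = |q t x - (1 / 2) * ‖v t x‖ ^ 2| * |fderiv ℝ (bumpSq η R) x (curl (v t) x)| := by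
            rw [hT₂]; exact abs_mul _ _
        _ ≤ (K / β ^ 2 + (1 / 2) * (D / β) ^ 2) * (M₁ / R * (κ * K / β ^ 2)) :=
            mul_le_mul h1 h2 (abs_nonneg _) (by positivity)
        _ = c₂ / (R * β ^ 4) := by rw [hc₂]; field_simp
    · -- `|⟪curl ω, ∇a × v⟫| ≤ (κ²K/β³) · κ (M₁/R)(D/β)`
      have h2 : ‖curlCLM ((fderiv ℝ (bumpSq η R) x).smulRight (v t x))‖ ≤ κ * (M₁ / R * (D / β)) :=
        (norm_curlCLM_smulRight_le _ _).trans
          (mul_le_mul_of_nonneg_left (mul_le_mul ha hv (norm_nonneg _) (by positivity)) hκ0)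
      calc |T₃ x| ≤ ‖curl (curl (v t)) x‖ * ‖curlCLM ((fderiv ℝ (bumpSq η R) x).smulRight (v t x))‖ := by
            rw [hT₃]; exact abs_real_inner_le_norm _ _
        _ ≤ κ ^ 2 * K / β ^ 3 * (κ * (M₁ / R * (D / β))) :=
            mul_le_mul hωω h2 (norm_nonneg _) (by positivity)
        _ = c₃ / (R * β ^ 4) := by rw [hc₃]; field_simp
  -- the three integral bounds
  have hI : ∀ {T : EuclideanSpace ℝ (Fin 3) → ℝ} {c : ℝ}, (∀ x, ‖x‖ ≤ 2 * R → |T x| ≤ c / (R * β ^ 4)) →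
      (∀ x, 2 * R < ‖x‖ → T x = 0) → |∫ x, T x| ≤ 8 * V₁ * c * (R ^ 2 * (β ^ 4)⁻¹) := by
    intro T c hTin hTout
    refine (abs_integral_le_of_ball_bound hR hTin hTout).trans (le_of_eq ?_)
    rw [hV₁]
    field_simp
  have hI₁ := hI (T := T₁) (fun x hx => (hin x hx).1) (fun x hx => (hout x hx).1)
  have hI₂ := hI (T := T₂) (fun x hx => (hin x hx).2.1) (fun x hx => (hout x hx).2.1)
  have hI₃ := hI (T := T₃) (fun x hx => (hin x hx).2.2) (fun x hx => (hout x hx).2.2)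
  -- assemble
  show |(∫ x, T₁ x) + (∫ x, T₂ x) - ∫ x, T₃ x| ≤ 8 * V₁ * (c₁ + c₂ + c₃) * (R ^ 2 * (β ^ 4)⁻¹)
  calc |(∫ x, T₁ x) + (∫ x, T₂ x) - ∫ x, T₃ x| ≤ |(∫ x, T₁ x) + (∫ x, T₂ x)| + |∫ x, T₃ x| := abs_sub _ _
    _ ≤ |∫ x, T₁ x| + |∫ x, T₂ x| + |∫ x, T₃ x| := by gcongr; exact abs_add_le _ _
    _ ≤ 8 * V₁ * c₁ * (R ^ 2 * (β ^ 4)⁻¹) + 8 * V₁ * c₂ * (R ^ 2 * (β ^ 4)⁻¹) + 8 * V₁ * c₃ * (R ^ 2 * (β ^ 4)⁻¹) :=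
        add_le_add (add_le_add hI₁ hI₂) hI₃
    _ = 8 * V₁ * (c₁ + c₂ + c₃) * (R ^ 2 * (β ^ 4)⁻¹) := by ring

end Summit.NavierStokesRegularity.NavierStokesRegularity.Theorems.ChiralWindowDoorHelicityFluxBounds

end
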